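import Mathlib
import HarnessLib
import Summits.ValiantsHypothesis.ValiantsHypothesis.Theorems.LacunarySymmetroidMatrixDescartesOsculationLawRankOneCurve
import Summits.ValiantsHypothesis.ValiantsHypothesis.Theorems.LacunarySymmetroidMatrixDescartesOsculationLawTwoKRankOne

/-!
# ValiantsHypothesis / LacunarySymmetroid — crux `MatrixDescartes` (stmt-ValiantsHypothesis-18050, V1),
# line `Cruxes/MatrixDescartes/Lines/osculation_law.lean` («osculation-law»): the CUSP CURVE `b² + τ·b + δ = 0`

For the block splitting `(r, s) = (2, 0)` of the `m = 2` rung of the line's law, the insertion polynomial is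
QUADRATIC in `b`: `Φ = det(G(t) + b·I₂) = b² + τ(t)·b + δ(t)` with `τ = tr G`, `δ = det G`.  This file bounds the
osculation set of such a curve for ARBITRARY `τ δ : ℝ[X]` whose discriminant is nonnegative on the real line
(`τ(t)² ≥ 4δ(t)`: both `b`-roots real, as for symmetric `G`):

* `eval_logHessian_Phi2` (θ-calculus for `Φ = X₁² + X₁·ι τ + ι δ`, `ι : X ↦ X₀`);
* `hess_reduce` (one `ring`): the bordered log-Hessian reduced modulo the monic quadratic,
  `H = Q·Φ + A·b + B` with `A`, `B` explicit polynomials in `τ, δ, θτ, θδ, θ²τ, θ²δ` (`θ = X·d/dX`;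
  computed by exact polynomial division in the seat, checked here by the kernel);
* `cusp_curve_ncard_le` (**main**): if the osculation set `{t > 0, b > 0, Φ = 0, H(Φ) = 0}` is finite then
  `#osc ≤ |supp N| + 2·|supp A| + 2·|supp B|`, `N = B² − τ·A·B + δ·A²`.  On the set, `A(t)·b + B(t) = 0` and
  `N(t) = A(t)²·Φ(t,b) = 0`; points with `A(t) ≠ 0` project injectively to positive roots of `N`, points with
  `A(t) = 0` have `B(t) = 0` and at most two `b` per abscissa; if `N ≡ 0`, resp. `A ≡ B ≡ 0`, the would-be points
  `(t, −B/A)` on `{A·B < 0}`, resp. `(t, r₊(t))` with `r₊ = (−τ + √(τ² − 4δ))/2 > 0`, fill an OPEN set of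
  abscissae, so finiteness forces emptiness (this is where the real-rootedness hypothesis is used).
  Distinct positive roots are bounded by monomial counts through Descartes' rule with multiplicity
  (`OsculationRankOne.card_roots_filter_pos_le_card_support`).

`…OsculationLawTwoK` turns the monomial counts into powers of `K` and assembles the `m = 2` rung.  Honest framing:
a located rung of an UNREGISTERED V1 law line; `OsculationLaw` (all `m`), `PeelInequality`, `MatrixDescartes`,
Conjecture B and `VP ≠ VNP` are OPEN / NOT proved; nothing here is progress on them.  No definitions, no named
facts; Mathlib only.
-/

-- `Summit.ValiantsHypothesis.ValiantsHypothesis.…` is the tree's mandated single-conjunct layout (Sub = Summit).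
set_option linter.dupNamespace false

noncomputable section

namespace Summit.ValiantsHypothesis.ValiantsHypothesis.Theorems.LacunarySymmetroidMatrixDescartes

open Polynomial Set
open scoped BigOperators

namespace OsculationCusp

/-! ### θ-calculus for `Φ = X₁² + X₁·ι τ + ι δ` -/

/-- `Φ(t,b) = b² + τ(t)·b + δ(t)`. [folklore] -/
theorem eval_Phi2 (τ δ : ℝ[X]) (p : Fin 2 → ℝ) :
    MvPolynomial.eval p (MvPolynomial.X 1 * MvPolynomial.X 1 + MvPolynomial.X 1 * Polynomial.aeval (MvPolynomial.X 0 : MvPolynomial (Fin 2) ℝ) τ + Polynomial.aeval (MvPolynomial.X 0 : MvPolynomial (Fin 2) ℝ) δ) = p 1 ^ 2 + p 1 * τ.eval (p 0) + δ.eval (p 0) := by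
  rw [sq]
  simp [OsculationRankOne.eval_aevalX0]

/-- The bordered log-Hessian of `Φ = X₁² + X₁·ι τ + ι δ` at `p = (t,b)`. [folklore] -/
theorem eval_logHessian_Phi2 (τ δ : ℝ[X]) (Φ : MvPolynomial (Fin 2) ℝ) (hΦ : Φ = (MvPolynomial.X 1 * MvPolynomial.X 1 + MvPolynomial.X 1 * Polynomial.aeval (MvPolynomial.X 0 : MvPolynomial (Fin 2) ℝ) τ + Polynomial.aeval (MvPolynomial.X 0 : MvPolynomial (Fin 2) ℝ) δ))
    (p : Fin 2 → ℝ) :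
    MvPolynomial.eval p
        (MvPolynomial.X 0 * MvPolynomial.pderiv 0 (MvPolynomial.X 0 * MvPolynomial.pderiv 0 Φ)
            * (MvPolynomial.X 1 * MvPolynomial.pderiv 1 Φ) ^ 2
          - 2 * (MvPolynomial.X 0 * MvPolynomial.pderiv 0 (MvPolynomial.X 1 * MvPolynomial.pderiv 1 Φ))
            * (MvPolynomial.X 0 * MvPolynomial.pderiv 0 Φ) * (MvPolynomial.X 1 * MvPolynomial.pderiv 1 Φ)
          + MvPolynomial.X 1 * MvPolynomial.pderiv 1 (MvPolynomial.X 1 * MvPolynomial.pderiv 1 Φ)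
            * (MvPolynomial.X 0 * MvPolynomial.pderiv 0 Φ) ^ 2) =
      (((p 0) * (derivative τ).eval (p 0) + (p 0) ^ 2 * (derivative (derivative τ)).eval (p 0)) * (p 1) + ((p 0) * (derivative δ).eval (p 0) + (p 0) ^ 2 * (derivative (derivative δ)).eval (p 0))) * (2 * (p 1) ^ 2 + τ.eval (p 0) * (p 1)) ^ 2 - 2 * (((p 0) * (derivative τ).eval (p 0)) * (p 1)) * (((p 0) * (derivative τ).eval (p 0)) * (p 1) + ((p 0) * (derivative δ).eval (p 0))) * (2 * (p 1) ^ 2 + τ.eval (p 0) * (p 1)) + (4 * (p 1) ^ 2 + τ.eval (p 0) * (p 1)) * (((p 0) * (derivative τ).eval (p 0)) * (p 1) + ((p 0) * (derivative δ).eval (p 0))) ^ 2 := by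
  subst hΦ
  simp only [map_add, map_sub, map_mul, map_pow, MvPolynomial.pderiv_mul,
    MvPolynomial.pderiv_X_self, MvPolynomial.pderiv_X_of_ne (show (1 : Fin 2) ≠ 0 by decide),
    OsculationRankOne.pderiv_zero_aevalX0, OsculationRankOne.pderiv_one_aevalX0,
    MvPolynomial.eval_X, OsculationRankOne.eval_aevalX0, map_ofNat, map_one, mul_zero, zero_mul, add_zero,
    zero_add, one_mul, mul_one]
  ring

/-- **Reduction of the Hessian modulo the monic quadratic** (`H = Q·Φ + A·b + B`; exact division, one `ring`).
[folklore] -/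
theorem hess_reduce (b T D T₁ D₁ T₂ D₂ : ℝ) :
    (T₂ * b + D₂) * (2 * b ^ 2 + T * b) ^ 2 - 2 * (T₁ * b) * (T₁ * b + D₁) * (2 * b ^ 2 + T * b) + (4 * b ^ 2 + T * b) * (T₁ * b + D₁) ^ 2 =
      (4 * b ^ 3 * T₂ + 4 * b ^ 2 * D₂ + b * T ^ 2 * T₂ - b * T * T₁ ^ 2 - 4 * b * D * T₂ + 4 * b * T₁ * D₁ - T ^ 3 * T₂ + T ^ 2 * T₁ ^ 2 + T ^ 2 * D₂ + 4 * T * D * T₂ - 4 * T * T₁ * D₁ - 4 * D * D₂ + 4 * D₁ ^ 2) * (b ^ 2 + T * b + D)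
        + (T ^ 4 * T₂ - T ^ 3 * T₁ ^ 2 - T ^ 3 * D₂ - 5 * T ^ 2 * D * T₂ + 4 * T ^ 2 * T₁ * D₁ + T * D * T₁ ^ 2 + 4 * T * D * D₂ - 3 * T * D₁ ^ 2 + 4 * D ^ 2 * T₂ - 4 * D * T₁ * D₁) * b
        + (T ^ 3 * D * T₂ - T ^ 2 * D * T₁ ^ 2 - T ^ 2 * D * D₂ - 4 * T * D ^ 2 * T₂ + 4 * T * D * T₁ * D₁ + 4 * D ^ 2 * D₂ - 4 * D * D₁ ^ 2) := by
  ring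

/-- `A(t)` as the value of the polynomial `A`. [folklore] -/
theorem eval_A (τ δ : ℝ[X]) (t : ℝ) :
    (τ ^ 4 * (X * derivative (X * derivative τ)) - τ ^ 3 * (X * derivative τ) ^ 2 - τ ^ 3 * (X * derivative (X * derivative δ)) - 5 * τ ^ 2 * δ * (X * derivative (X * derivative τ)) + 4 * τ ^ 2 * (X * derivative τ) * (X * derivative δ) + τ * δ * (X * derivative τ) ^ 2 + 4 * τ * δ * (X * derivative (X * derivative δ)) - 3 * τ * (X * derivative δ) ^ 2 + 4 * δ ^ 2 * (X * derivative (X * derivative τ)) - 4 * δ * (X * derivative τ) * (X * derivative δ)).eval t =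
      τ.eval (t) ^ 4 * ((t) * (derivative τ).eval (t) + (t) ^ 2 * (derivative (derivative τ)).eval (t)) - τ.eval (t) ^ 3 * ((t) * (derivative τ).eval (t)) ^ 2 - τ.eval (t) ^ 3 * ((t) * (derivative δ).eval (t) + (t) ^ 2 * (derivative (derivative δ)).eval (t)) - 5 * τ.eval (t) ^ 2 * δ.eval (t) * ((t) * (derivative τ).eval (t) + (t) ^ 2 * (derivative (derivative τ)).eval (t)) + 4 * τ.eval (t) ^ 2 * ((t) * (derivative τ).eval (t)) * ((t) * (derivative δ).eval (t)) + τ.eval (t) * δ.eval (t) * ((t) * (derivative τ).eval (t)) ^ 2 + 4 * τ.eval (t) * δ.eval (t) * ((t) * (derivative δ).eval (t) + (t) ^ 2 * (derivative (derivative δ)).eval (t)) - 3 * τ.eval (t) * ((t) * (derivative δ).eval (t)) ^ 2 + 4 * δ.eval (t) ^ 2 * ((t) * (derivative τ).eval (t) + (t) ^ 2 * (derivative (derivative τ)).eval (t)) - 4 * δ.eval (t) * ((t) * (derivative τ).eval (t)) * ((t) * (derivative δ).eval (t)) := by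
  simp only [eval_add, eval_sub, eval_mul, eval_pow, eval_X, eval_ofNat, derivative_mul, derivative_X, one_mul]
  ring

/-- `B(t)` as the value of the polynomial `B`. [folklore] -/
theorem eval_B (τ δ : ℝ[X]) (t : ℝ) :
    (τ ^ 3 * δ * (X * derivative (X * derivative τ)) - τ ^ 2 * δ * (X * derivative τ) ^ 2 - τ ^ 2 * δ * (X * derivative (X * derivative δ)) - 4 * τ * δ ^ 2 * (X * derivative (X * derivative τ)) + 4 * τ * δ * (X * derivative τ) * (X * derivative δ) + 4 * δ ^ 2 * (X * derivative (X * derivative δ)) - 4 * δ * (X * derivative δ) ^ 2).eval t =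
      τ.eval (t) ^ 3 * δ.eval (t) * ((t) * (derivative τ).eval (t) + (t) ^ 2 * (derivative (derivative τ)).eval (t)) - τ.eval (t) ^ 2 * δ.eval (t) * ((t) * (derivative τ).eval (t)) ^ 2 - τ.eval (t) ^ 2 * δ.eval (t) * ((t) * (derivative δ).eval (t) + (t) ^ 2 * (derivative (derivative δ)).eval (t)) - 4 * τ.eval (t) * δ.eval (t) ^ 2 * ((t) * (derivative τ).eval (t) + (t) ^ 2 * (derivative (derivative τ)).eval (t)) + 4 * τ.eval (t) * δ.eval (t) * ((t) * (derivative τ).eval (t)) * ((t) * (derivative δ).eval (t)) + 4 * δ.eval (t) ^ 2 * ((t) * (derivative δ).eval (t) + (t) ^ 2 * (derivative (derivative δ)).eval (t)) - 4 * δ.eval (t) * ((t) * (derivative δ).eval (t)) ^ 2 := by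
  simp only [eval_add, eval_sub, eval_mul, eval_pow, eval_X, eval_ofNat, derivative_mul, derivative_X, one_mul]
  ring


/-- The reduction on the curve, with `A`, `B` as polynomials: if `b² + b·τ(t) + δ(t) = 0` then
`H(Φ)(t,b) = 0 ↔ A(t)·b + B(t) = 0`. [folklore] -/
theorem hess_reduce_poly (τ δ : ℝ[X]) (t b : ℝ) (hΦ0 : b ^ 2 + b * τ.eval t + δ.eval t = 0) :
    (((t) * (derivative τ).eval (t) + (t) ^ 2 * (derivative (derivative τ)).eval (t)) * ((b)) + ((t) * (derivative δ).eval (t) + (t) ^ 2 * (derivative (derivative δ)).eval (t))) * (2 * ((b)) ^ 2 + τ.eval (t) * ((b))) ^ 2 - 2 * (((t) * (derivative τ).eval (t)) * ((b))) * (((t) * (derivative τ).eval (t)) * ((b)) + ((t) * (derivative δ).eval (t))) * (2 * ((b)) ^ 2 + τ.eval (t) * ((b))) + (4 * ((b)) ^ 2 + τ.eval (t) * ((b))) * (((t) * (derivative τ).eval (t)) * ((b)) + ((t) * (derivative δ).eval (t))) ^ 2 = 0 ↔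
      (τ ^ 4 * (X * derivative (X * derivative τ)) - τ ^ 3 * (X * derivative τ) ^ 2 - τ ^ 3 * (X * derivative (X * derivative δ)) - 5 * τ ^ 2 * δ * (X * derivative (X * derivative τ)) + 4 * τ ^ 2 * (X * derivative τ) * (X * derivative δ) + τ * δ * (X * derivative τ) ^ 2 + 4 * τ * δ * (X * derivative (X * derivative δ)) - 3 * τ * (X * derivative δ) ^ 2 + 4 * δ ^ 2 * (X * derivative (X * derivative τ)) - 4 * δ * (X * derivative τ) * (X * derivative δ)).eval t * b + (τ ^ 3 * δ * (X * derivative (X * derivative τ)) - τ ^ 2 * δ * (X * derivative τ) ^ 2 - τ ^ 2 * δ * (X * derivative (X * derivative δ)) - 4 * τ * δ ^ 2 * (X * derivative (X * derivative τ)) + 4 * τ * δ * (X * derivative τ) * (X * derivative δ) + 4 * δ ^ 2 * (X * derivative (X * derivative δ)) - 4 * δ * (X * derivative δ) ^ 2).eval t = 0 := by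
  have hred := hess_reduce (b) (τ.eval (t)) (δ.eval (t)) ((t) * (derivative τ).eval (t)) ((t) * (derivative δ).eval (t)) ((t) * (derivative τ).eval (t) + (t) ^ 2 * (derivative (derivative τ)).eval (t)) ((t) * (derivative δ).eval (t) + (t) ^ 2 * (derivative (derivative δ)).eval (t))
  rw [show (b) ^ 2 + τ.eval (t) * (b) + δ.eval (t) = 0 by linarith, mul_zero, zero_add] at hred
  rw [hred, eval_A, eval_B]


/-! ### Infinite osculation sets from open arcs -/

/-- A curve `t ↦ (t, γ t)` over an open nonempty set of abscissae inside a set of the plane makes it infinite.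
[folklore] -/
theorem infinite_of_curve {osc : Set (Fin 2 → ℝ)} {U : Set ℝ} (hU : IsOpen U) {t₀ : ℝ} (ht₀ : t₀ ∈ U)
    (γ : ℝ → ℝ) (hmaps : ∀ t ∈ U, (![t, γ t] : Fin 2 → ℝ) ∈ osc) : osc.Infinite := by
  obtain ⟨ε, hε, hball⟩ := Metric.isOpen_iff.1 hU t₀ ht₀
  have hUinf : U.Infinite := by
    refine Set.Infinite.mono ?_ (Set.Ioo_infinite (show t₀ - ε < t₀ + ε by linarith))
    intro t ht
    apply hball
    rw [Real.ball_eq_Ioo]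
    exact ht
  refine Set.infinite_of_injOn_mapsTo (f := fun t : ℝ => (![t, γ t] : Fin 2 → ℝ)) ?_ hmaps hUinf
  intro t _ t' _ htt'
  have := congr_fun htt' 0
  simpa [Matrix.cons_val_zero] using this

/-! ### The cusp count -/

/-- **Cusp curve.**  For `Φ = X₁² + X₁·ι τ + ι δ` with `τ² ≥ 4δ` on `ℝ` (both `b`-roots real), a finite
osculation set has at most `|supp N| + 2|supp A| + 2|supp B|` points (`A`, `B` the remainder of the bordered
log-Hessian modulo `Φ`, `N = B² − τAB + δA²`). -/
theorem cusp_curve_ncard_le (τ δ : ℝ[X]) (Φ : MvPolynomial (Fin 2) ℝ) (hΦ : Φ = (MvPolynomial.X 1 * MvPolynomial.X 1 + MvPolynomial.X 1 * Polynomial.aeval (MvPolynomial.X 0 : MvPolynomial (Fin 2) ℝ) τ + Polynomial.aeval (MvPolynomial.X 0 : MvPolynomial (Fin 2) ℝ) δ))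
    (hdisc : ∀ t : ℝ, 4 * δ.eval t ≤ τ.eval t ^ 2) (A B : ℝ[X])
    (hABgen : ∀ t b : ℝ, b ^ 2 + b * τ.eval t + δ.eval t = 0 →
      ((((t) * (derivative τ).eval (t) + (t) ^ 2 * (derivative (derivative τ)).eval (t)) * ((b)) + ((t) * (derivative δ).eval (t) + (t) ^ 2 * (derivative (derivative δ)).eval (t))) * (2 * ((b)) ^ 2 + τ.eval (t) * ((b))) ^ 2 - 2 * (((t) * (derivative τ).eval (t)) * ((b))) * (((t) * (derivative τ).eval (t)) * ((b)) + ((t) * (derivative δ).eval (t))) * (2 * ((b)) ^ 2 + τ.eval (t) * ((b))) + (4 * ((b)) ^ 2 + τ.eval (t) * ((b))) * (((t) * (derivative τ).eval (t)) * ((b)) + ((t) * (derivative δ).eval (t))) ^ 2 = 0 ↔ A.eval t * b + B.eval t = 0))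
    (hfin : {p : Fin 2 → ℝ | 0 < p 0 ∧ 0 < p 1 ∧ MvPolynomial.eval p Φ = 0 ∧
      MvPolynomial.eval p
        (MvPolynomial.X 0 * MvPolynomial.pderiv 0 (MvPolynomial.X 0 * MvPolynomial.pderiv 0 Φ)
            * (MvPolynomial.X 1 * MvPolynomial.pderiv 1 Φ) ^ 2
          - 2 * (MvPolynomial.X 0 * MvPolynomial.pderiv 0 (MvPolynomial.X 1 * MvPolynomial.pderiv 1 Φ))
            * (MvPolynomial.X 0 * MvPolynomial.pderiv 0 Φ) * (MvPolynomial.X 1 * MvPolynomial.pderiv 1 Φ)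
          + MvPolynomial.X 1 * MvPolynomial.pderiv 1 (MvPolynomial.X 1 * MvPolynomial.pderiv 1 Φ)
            * (MvPolynomial.X 0 * MvPolynomial.pderiv 0 Φ) ^ 2) = 0}.Finite) :
    {p : Fin 2 → ℝ | 0 < p 0 ∧ 0 < p 1 ∧ MvPolynomial.eval p Φ = 0 ∧
      MvPolynomial.eval p
        (MvPolynomial.X 0 * MvPolynomial.pderiv 0 (MvPolynomial.X 0 * MvPolynomial.pderiv 0 Φ)
            * (MvPolynomial.X 1 * MvPolynomial.pderiv 1 Φ) ^ 2
          - 2 * (MvPolynomial.X 0 * MvPolynomial.pderiv 0 (MvPolynomial.X 1 * MvPolynomial.pderiv 1 Φ))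
            * (MvPolynomial.X 0 * MvPolynomial.pderiv 0 Φ) * (MvPolynomial.X 1 * MvPolynomial.pderiv 1 Φ)
          + MvPolynomial.X 1 * MvPolynomial.pderiv 1 (MvPolynomial.X 1 * MvPolynomial.pderiv 1 Φ)
            * (MvPolynomial.X 0 * MvPolynomial.pderiv 0 Φ) ^ 2) = 0}.ncard ≤ (B ^ 2 - τ * A * B + δ * A ^ 2).support.card + 2 * A.support.card + 2 * B.support.card := by
  classical
  set N : ℝ[X] := B ^ 2 - τ * A * B + δ * A ^ 2 with hN
  set osc := {p : Fin 2 → ℝ | 0 < p 0 ∧ 0 < p 1 ∧ MvPolynomial.eval p Φ = 0 ∧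
      MvPolynomial.eval p
        (MvPolynomial.X 0 * MvPolynomial.pderiv 0 (MvPolynomial.X 0 * MvPolynomial.pderiv 0 Φ)
            * (MvPolynomial.X 1 * MvPolynomial.pderiv 1 Φ) ^ 2
          - 2 * (MvPolynomial.X 0 * MvPolynomial.pderiv 0 (MvPolynomial.X 1 * MvPolynomial.pderiv 1 Φ))
            * (MvPolynomial.X 0 * MvPolynomial.pderiv 0 Φ) * (MvPolynomial.X 1 * MvPolynomial.pderiv 1 Φ)
          + MvPolynomial.X 1 * MvPolynomial.pderiv 1 (MvPolynomial.X 1 * MvPolynomial.pderiv 1 Φ)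
            * (MvPolynomial.X 0 * MvPolynomial.pderiv 0 Φ) ^ 2) = 0} with hosc
  -- membership in real numbers
  have mem_osc : ∀ p : Fin 2 → ℝ, p ∈ osc ↔ 0 < p 0 ∧ 0 < p 1 ∧
      p 1 ^ 2 + p 1 * τ.eval (p 0) + δ.eval (p 0) = 0 ∧
      (((p 0) * (derivative τ).eval (p 0) + (p 0) ^ 2 * (derivative (derivative τ)).eval (p 0)) * (p 1) + ((p 0) * (derivative δ).eval (p 0) + (p 0) ^ 2 * (derivative (derivative δ)).eval (p 0))) * (2 * (p 1) ^ 2 + τ.eval (p 0) * (p 1)) ^ 2 - 2 * (((p 0) * (derivative τ).eval (p 0)) * (p 1)) * (((p 0) * (derivative τ).eval (p 0)) * (p 1) + ((p 0) * (derivative δ).eval (p 0))) * (2 * (p 1) ^ 2 + τ.eval (p 0) * (p 1)) + (4 * (p 1) ^ 2 + τ.eval (p 0) * (p 1)) * (((p 0) * (derivative τ).eval (p 0)) * (p 1) + ((p 0) * (derivative δ).eval (p 0))) ^ 2 = 0 := by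
    intro p
    rw [hosc, Set.mem_setOf_eq, eval_logHessian_Phi2 τ δ Φ hΦ p, hΦ, eval_Phi2]
  have hAB : ∀ p ∈ osc, A.eval (p 0) * p 1 + B.eval (p 0) = 0 := by
    intro p hp
    obtain ⟨-, -, hΦ0, hH⟩ := (mem_osc p).1 hp
    exact (hABgen (p 0) (p 1) hΦ0).1 hH
  -- `N(t) = A(t)²·Φ(t,b) = 0` on the set
  have hNroot : ∀ p ∈ osc, N.IsRoot (p 0) := by
    intro p hp
    obtain ⟨-, -, hΦ0, -⟩ := (mem_osc p).1 hp
    have hb : B.eval (p 0) = -(A.eval (p 0) * p 1) := by linarith [hAB p hp]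
    rw [IsRoot.def, hN]
    simp only [eval_sub, eval_add, eval_mul, eval_pow]
    rw [hb]
    linear_combination (A.eval (p 0)) ^ 2 * hΦ0
  -- trivial case: empty set
  rcases Set.eq_empty_or_nonempty osc with hempty | ⟨p₀, hp₀⟩
  · rw [hempty, Set.ncard_empty]; exact Nat.zero_le _
  -- FULLY DEGENERATE CASE `A = 0 ∧ B = 0`: the upper root `r₊` traces an open arc of osculation points
  by_cases hdeg : A = 0 ∧ B = 0
  · exfalso
    obtain ⟨hA0, hB0⟩ := hdeg
    obtain ⟨ht₀, hb₀, hΦ₀, -⟩ := (mem_osc p₀).1 hp₀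
    set r : ℝ → ℝ := fun t => (-τ.eval t + Real.sqrt (τ.eval t ^ 2 - 4 * δ.eval t)) / 2 with hr
    have hr_cont : Continuous r := by
      have h1 : Continuous fun t => τ.eval t := τ.continuous
      have h2 : Continuous fun t => δ.eval t := δ.continuous
      exact ((h1.neg).add ((h1.pow 2).sub (continuous_const.mul h2)).sqrt).div_const 2
    have hr_root : ∀ t, r t ^ 2 + r t * τ.eval t + δ.eval t = 0 := by
      intro t
      have hs : Real.sqrt (τ.eval t ^ 2 - 4 * δ.eval t) * Real.sqrt (τ.eval t ^ 2 - 4 * δ.eval t) =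
          τ.eval t ^ 2 - 4 * δ.eval t := Real.mul_self_sqrt (by linarith [hdisc t])
      have : r t ^ 2 + r t * τ.eval t + δ.eval t =
          (Real.sqrt (τ.eval t ^ 2 - 4 * δ.eval t) * Real.sqrt (τ.eval t ^ 2 - 4 * δ.eval t)
            - (τ.eval t ^ 2 - 4 * δ.eval t)) / 4 := by
        rw [hr]; ring
      rw [this, hs, sub_self, zero_div]
    have hr₀ : p₀ 1 ≤ r (p₀ 0) := by
      have hs0 : 0 ≤ Real.sqrt (τ.eval (p₀ 0) ^ 2 - 4 * δ.eval (p₀ 0)) := Real.sqrt_nonneg _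
      have hsq : (2 * p₀ 1 + τ.eval (p₀ 0)) ^ 2 = Real.sqrt (τ.eval (p₀ 0) ^ 2 - 4 * δ.eval (p₀ 0)) ^ 2 := by
        rw [sq (Real.sqrt _), Real.mul_self_sqrt (by linarith [hdisc (p₀ 0)])]
        linear_combination 4 * hΦ₀
      rcases sq_eq_sq_iff_eq_or_eq_neg.1 hsq with h | h
      · rw [hr]; dsimp only; linarith
      · rw [hr]; dsimp only; linarith
    apply hfin.not_infinite
    refine infinite_of_curve (U := {t | 0 < t ∧ 0 < r t})
      ((isOpen_lt continuous_const continuous_id).inter (isOpen_lt continuous_const hr_cont))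
      (t₀ := p₀ 0) ⟨ht₀, lt_of_lt_of_le hb₀ hr₀⟩ r ?_
    intro t ht
    obtain ⟨htpos, hrpos⟩ := ht
    refine (mem_osc _).2 ⟨?_, ?_, ?_, ?_⟩
    · simpa [Matrix.cons_val_zero] using htpos
    · simpa [Matrix.cons_val_one] using hrpos
    · simp only [Matrix.cons_val_zero, Matrix.cons_val_one]; exact hr_root t
    · simp only [Matrix.cons_val_zero, Matrix.cons_val_one]
      rw [(hABgen t (r t) (hr_root t)), hA0, hB0]
      simp
  -- the two parts of the set
  set O₁ := {p ∈ osc | A.eval (p 0) ≠ 0} with hO₁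
  set O₂ := {p ∈ osc | A.eval (p 0) = 0} with hO₂
  have hsplit : osc = O₁ ∪ O₂ := by
    ext p
    simp only [hO₁, hO₂, Set.mem_union, Set.mem_setOf_eq]
    tauto
  have hO₁fin : O₁.Finite := hfin.subset (fun p hp => hp.1)
  have hO₂fin : O₂.Finite := hfin.subset (fun p hp => hp.1)
  -- (1) `O₁` projects injectively into the positive roots of `N`; if `N ≡ 0` it is empty
  have hO₁card : O₁.ncard ≤ N.support.card := by
    by_cases hN0 : N = 0
    · -- `N ≡ 0`: the points `(t, -B/A)` over the open set `{A·B < 0}` would all be osculation points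
      have hO₁empty : O₁ = ∅ := by
        rcases Set.eq_empty_or_nonempty O₁ with h | ⟨p, hp⟩
        · exact h
        exfalso
        obtain ⟨hposc, hAp⟩ := hp
        obtain ⟨htp, hbp, -, -⟩ := (mem_osc p).1 hposc
        have hABp := hAB p hposc
        apply hfin.not_infinite
        have hcA : Continuous fun t => A.eval t := A.continuous
        have hcB : Continuous fun t => B.eval t := B.continuous
        refine infinite_of_curve (U := {t | 0 < t ∧ A.eval t * B.eval t < 0})
          ((isOpen_lt continuous_const continuous_id).inter (isOpen_lt (hcA.mul hcB) continuous_const))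
          (t₀ := p 0) ⟨htp, ?_⟩ (fun t => -(B.eval t) / A.eval t) ?_
        · have hBp : B.eval (p 0) = -(A.eval (p 0) * p 1) := by linarith
          rw [hBp]
          have h2 : 0 < A.eval (p 0) * A.eval (p 0) * p 1 := mul_pos (mul_self_pos.2 hAp) hbp
          nlinarith
        · intro t ht
          obtain ⟨htpos, hprod⟩ := ht
          have hAt : A.eval t ≠ 0 := by
            intro h0; rw [h0, zero_mul] at hprod; exact lt_irrefl _ hprod
          have hcurve : (-(B.eval t) / A.eval t) ^ 2 + (-(B.eval t) / A.eval t) * τ.eval t + δ.eval t = 0 := by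
            have hNt : N.eval t = 0 := by rw [hN0, eval_zero]
            rw [hN] at hNt
            simp only [eval_sub, eval_add, eval_mul, eval_pow] at hNt
            have hA2 : A.eval t ^ 2 ≠ 0 := pow_ne_zero 2 hAt
            apply mul_left_cancel₀ hA2
            rw [mul_zero]
            have : A.eval t ^ 2 * ((-(B.eval t) / A.eval t) ^ 2 + (-(B.eval t) / A.eval t) * τ.eval t + δ.eval t) =
                B.eval t ^ 2 - τ.eval t * A.eval t * B.eval t + δ.eval t * A.eval t ^ 2 := by
              field_simp
              ring
            rw [this]
            linarith
          refine (mem_osc _).2 ⟨?_, ?_, ?_, ?_⟩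
          · simpa [Matrix.cons_val_zero] using htpos
          · simp only [Matrix.cons_val_one, Matrix.cons_val_zero]
            have h1 : -(B.eval t) / A.eval t = (-(A.eval t * B.eval t)) / (A.eval t * A.eval t) := by
              field_simp
            rw [h1]
            exact div_pos (by linarith) (mul_self_pos.2 hAt)
          · simp only [Matrix.cons_val_zero, Matrix.cons_val_one]; exact hcurve
          · simp only [Matrix.cons_val_zero, Matrix.cons_val_one]
            rw [hABgen t _ hcurve]
            field_simp
            ring
      rw [hO₁empty, Set.ncard_empty]; exact Nat.zero_le _
    · have hmaps : ∀ p ∈ O₁, (fun p : Fin 2 → ℝ => p 0) p ∈ ((N.roots.toFinset.filter (fun t => 0 < t) : Finset ℝ) : Set ℝ) := by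
        intro p hp
        obtain ⟨htp, -, -, -⟩ := (mem_osc p).1 hp.1
        simp only [Finset.coe_filter, Set.mem_setOf_eq, Multiset.mem_toFinset]
        exact ⟨(mem_roots hN0).2 (hNroot p hp.1), htp⟩
      have hinj : Set.InjOn (fun p : Fin 2 → ℝ => p 0) O₁ := by
        intro p hp q hq hpq
        simp only at hpq
        have h1 := hAB p hp.1
        have h2 := hAB q hq.1
        rw [← hpq] at h2
        have hb : p 1 = q 1 := by
          have : A.eval (p 0) * (p 1 - q 1) = 0 := by linarith
          rcases mul_eq_zero.1 this with h | h
          · exact absurd h hp.2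
          · linarith
        funext i
        fin_cases i
        · exact hpq
        · exact hb
      calc O₁.ncard ≤ ((N.roots.toFinset.filter (fun t => 0 < t) : Finset ℝ) : Set ℝ).ncard :=
            Set.ncard_le_ncard_of_injOn _ hmaps hinj (Finset.finite_toSet _)
        _ = (N.roots.toFinset.filter (fun t => 0 < t)).card := Set.ncard_coe_finset _
        _ = (N.roots.filter (fun t => 0 < t)).toFinset.card := by rw [Multiset.toFinset_filter]
        _ ≤ Multiset.card (N.roots.filter (fun t => 0 < t)) := Multiset.toFinset_card_le _
        _ ≤ N.support.card := OsculationRankOne.card_roots_filter_pos_le_card_support N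
  -- (2) `O₂`: abscissae are common positive roots of `A` and `B`; at most two ordinates each
  have hO₂card : O₂.ncard ≤ 2 * A.support.card + 2 * B.support.card := by
    -- the carrier of abscissae
    have key : ∀ (P : ℝ[X]), P ≠ 0 → (∀ p ∈ O₂, P.IsRoot (p 0)) → O₂.ncard ≤ 2 * P.support.card := by
      intro P hP0 hProot
      set TP : Finset ℝ := P.roots.toFinset.filter (fun t => 0 < t) with hTP
      set quad : ℝ → ℝ[X] := fun t => C 1 * X ^ 2 + C (τ.eval t) * X + C (δ.eval t) with hquad
      have hquad_ne : ∀ t, quad t ≠ 0 := by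
        intro t h0
        have := Polynomial.natDegree_quadratic (a := (1 : ℝ)) (b := τ.eval t) (c := δ.eval t) one_ne_zero
        rw [hquad] at h0
        simp only at h0
        rw [h0, natDegree_zero] at this
        exact absurd this (by norm_num)
      set S : Finset (Fin 2 → ℝ) :=
        TP.biUnion (fun t => ((quad t).roots.toFinset).image (fun b => (![t, b] : Fin 2 → ℝ))) with hS
      have hsub : O₂ ⊆ (S : Set (Fin 2 → ℝ)) := by
        intro p hp
        obtain ⟨htp, -, hΦp, -⟩ := (mem_osc p).1 hp.1
        rw [Finset.mem_coe, hS, Finset.mem_biUnion]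
        refine ⟨p 0, ?_, ?_⟩
        · rw [hTP, Finset.mem_filter, Multiset.mem_toFinset, mem_roots hP0]
          exact ⟨hProot p hp, htp⟩
        · rw [Finset.mem_image]
          refine ⟨p 1, ?_, ?_⟩
          · rw [Multiset.mem_toFinset, mem_roots (hquad_ne _), hquad, IsRoot.def]
            simp only [eval_add, eval_mul, eval_C, eval_pow, eval_X, one_mul]
            linarith
          · funext i
            fin_cases i <;> rfl
      calc O₂.ncard ≤ (S : Set (Fin 2 → ℝ)).ncard := Set.ncard_le_ncard hsub (Finset.finite_toSet _)
        _ = S.card := Set.ncard_coe_finset _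
        _ ≤ ∑ t ∈ TP, (((quad t).roots.toFinset).image (fun b => (![t, b] : Fin 2 → ℝ))).card :=
            Finset.card_biUnion_le
        _ ≤ ∑ t ∈ TP, 2 := by
            refine Finset.sum_le_sum fun t _ => ?_
            calc _ ≤ ((quad t).roots.toFinset).card := Finset.card_image_le
              _ ≤ Multiset.card (quad t).roots := Multiset.toFinset_card_le _
              _ ≤ (quad t).natDegree := Polynomial.card_roots' _
              _ = 2 := by rw [hquad]; exact Polynomial.natDegree_quadratic one_ne_zero
        _ = 2 * TP.card := by rw [Finset.sum_const, smul_eq_mul, mul_comm]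
        _ ≤ 2 * P.support.card := by
            apply Nat.mul_le_mul_left
            calc TP.card = (P.roots.filter (fun t => 0 < t)).toFinset.card := by
                  rw [hTP, Multiset.toFinset_filter]
              _ ≤ Multiset.card (P.roots.filter (fun t => 0 < t)) := Multiset.toFinset_card_le _
              _ ≤ P.support.card := OsculationRankOne.card_roots_filter_pos_le_card_support P
    have hBroot : ∀ p ∈ O₂, B.IsRoot (p 0) := by
      intro p hp
      have := hAB p hp.1
      rw [hp.2, zero_mul, zero_add] at this
      exact this
    by_cases hA0 : A = 0
    · have hB0 : B ≠ 0 := fun h => hdeg ⟨hA0, h⟩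
      have := key B hB0 hBroot
      omega
    · have := key A hA0 (fun p hp => hp.2)
      omega
  -- conclusion
  calc osc.ncard = (O₁ ∪ O₂).ncard := by rw [← hsplit]
    _ ≤ O₁.ncard + O₂.ncard := Set.ncard_union_le _ _
    _ ≤ N.support.card + (2 * A.support.card + 2 * B.support.card) := Nat.add_le_add hO₁card hO₂card
    _ = _ := by ring

end OsculationCusp

end Summit.ValiantsHypothesis.ValiantsHypothesis.Theorems.LacunarySymmetroidMatrixDescartes
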